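import Summits.HodgeConjecture.HodgeConjecture.Theorems.MarkmanPartnerTransportK3Sq2OneCycleFifthRM
import Summits.HodgeConjecture.HodgeConjecture.Theorems.MarkmanPartnerTransportK3Sq2OneCycleHodge
import Literature.AlgebraicGeometry.HodgeTheory.BettiCorrespondenceActionHodgeType
import Literature.AlgebraicGeometry.HodgeTheory.ComplexConjugationHolds

/-!
# Route MarkmanPartnerTransport · crux #5 — the one-cycle theorems with ONE RATIONAL ALGEBRAIC CLASS as the only
# datum (the action `[Z]_*` is then automatically rational and type-preserving)

In `…K3Sq2OneCycleHodge` / `…K3Sq2OneCycleFifth{,RM}` the cycle-induced endomorphism `t = [Z]_*` carries the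
hypotheses "rational" and "type-preserving" separately. For `Z` a RATIONAL class in `A⁴(X × X)` (as the class of an
actual algebraic cycle is) both are automatic: `[Z]_*` preserves rational classes (the tree's
`isRationalClass_corrAction_complexOrientationFamily`) and Hodge types (`isOfHodgeType_corrAction_of_type_self`:
an algebraic class has type `(4,4)`, `isOfHodgeType_of_mem_algebraicClasses_of_isSmoothProjective`). Hence:

* `typePreserving_corrAction_of_mem_algebraicClasses`, `isRationalClass_corrAction_of_isRationalClass`;
* `hodgeConjectureFor_of_algebraicClass_of_picard_two` — **a marked smooth projective `K3^{[2]}`-type `X` with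
  `ρ(X) = 2` carrying ONE rational algebraic class `Z ∈ A⁴(X × X)` with `[Z]_* σ = ev · σ`, `ev ∉ ℚ`, satisfies
  HC⁴(X)** modulo {Verbitsky–Guan, O'Grady, `QInvAlgebraic`} — the cleanest form of «one cycle suffices»;
* `hodgeConjectureFor_of_algebraicClass_of_four_facts` — any rank, arithmetic side condition, no CM clause;
* `lowPicardRealMultiplication_of_rationalAlgebraicClass` — crux #5 BY NAME from «every marked `X` with
  `ρ(X) ≤ 3` and genuine real multiplication carries one rational algebraic `Z ∈ A⁴(X × X)` whose action has
  eigenvalue `ev` on `σ` with `deg minpoly_ℚ(ev) = k`, `k·j·m + ρ(X) ≠ 23`».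

CONDITIONAL on the displayed named facts; no definition, no sorry. Prover seat hodge-nonav-19652-p1 (gen 8),
`--supports stmt-HodgeConjecture-19653`. Nothing here proves the crux or HC.

References: C. Voisin, *Hodge Theory I*, §11.1.2 Prop. 11.20, §11.3.3 Lemma 11.41; E. Markman, Compos. Math. 160
(2024) Thm. 1.1; B. van Geemen, Michigan Math. J. 56 (2008) Lemma 3.2.
-/

noncomputable section

set_option linter.dupNamespace false

open Module CategoryTheory MonoidalCategory Polynomial
open Literature.AlgebraicTopology.SingularHomology Literature.Geometry.Kaehler
open Literature.AlgebraicGeometry Literature.AlgebraicGeometry.Motives Literature.AlgebraicGeometry.HodgeTheory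
open Literature.AlgebraicGeometry.Hyperkaehler Literature.AlgebraicGeometry.Surfaces
open Summit.HodgeConjecture.HodgeConjecture.Theorems.NikulinTwinTransport

namespace Summit.HodgeConjecture.HodgeConjecture.Theorems.MarkmanPartnerTransport.PartnerLattice

/-- `MarkedK3Sq[X, φ, P, z]`: VERBATIM the `let MarkedK3Sq := …` binder of the route declarations of
MarkmanPartnerTransport (clauses (m1)–(m6)). Local notation only. -/
local notation3 (prettyPrint := false) "MarkedK3Sq[" X ", " φ ", " P ", " z "]" =>
  (((IsIntegralClass P ∧ ∀ Q : complexBetti X (2 * 4), IsIntegralClass Q → ∃ n : ℤ, Q = n • P) ∧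
    (∀ c : complexBetti X 2, IsIntegralClass c ↔ ∃ v : K3HilbertIndex → ℤ, φ c = fun i => (v i : ℂ)) ∧
    (∀ a : complexBetti X 2, cupPowTwo a 4 = ((3 : ℂ) * (k3HilbertForm 2 (φ a) (φ a)) ^ 2) • P) ∧
    (IsOfHodgeType 4 X 2 2 0 (LinearEquiv.symm φ z) ∧
      ∀ τ : complexBetti X 2, IsOfHodgeType 4 X 2 2 0 τ → ∃ t : ℂ, τ = t • LinearEquiv.symm φ z) ∧
    (∀ c : complexBetti X 2, IsOfHodgeType 4 X 2 1 1 c ↔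
      (k3HilbertForm 2 (φ c) z = 0 ∧ k3HilbertForm 2 (φ c) (star z) = 0)) ∧
    (k3HilbertForm 2 z z = 0 ∧ 0 < (k3HilbertForm 2 (star z) z).re)))

/-- `RM[X, φ, z]`: «`X` has genuine real multiplication» (as in `…K3Sq2OneCycleFifthRM`). Local notation only. -/
local notation3 (prettyPrint := false) "RM[" X ", " φ ", " z "]" =>
  (∃ e : complexBetti X 2 →ₗ[ℂ] complexBetti X 2, (∀ y, IsRationalClass y → IsRationalClass (e y)) ∧
    (∀ (i j : ℕ) y, IsOfHodgeType 4 X 2 i j y → IsOfHodgeType 4 X 2 i j (e y)) ∧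
    ∃ ev : ℂ, e (LinearEquiv.symm φ z) = ev • LinearEquiv.symm φ z ∧ ev.im = 0 ∧ ∀ a : ℚ, (a : ℂ) ≠ ev)

variable {X : SchemeOver ℂ} {φ : complexBetti X 2 ≃ₗ[ℂ] (K3HilbertIndex → ℂ)} {P : complexBetti X (2 * 4)}
  {z : K3HilbertIndex → ℂ}

/-! ### The action of an algebraic class is type-preserving; of a rational class, rational -/

/-- **The action `[Z]_*` of an algebraic class `Z ∈ A⁴(X × X)` on `H²(X(ℂ); ℂ)` preserves Hodge types** (`Z` has
type `(4,4)`; a class of type `(c,c)` acts with bidegree `(c − n, c − n) = (0,0)`).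
[cite: VoisinHodgeI2002, §11.1.2 Prop. 11.20 and §11.3.3 Lemma 11.41] -/
theorem typePreserving_corrAction_of_mem_algebraicClasses (hX : IsSmoothProjective 4 X)
    {Z : complexBetti (X ⊗ X) (2 * 4)} (hZ : Z ∈ algebraicClasses (X ⊗ X) 4) (a b : ℕ) (y : complexBetti X 2)
    (hy : IsOfHodgeType 4 X 2 a b y) :
    IsOfHodgeType 4 X 2 a b (corrAction complexOrientationFamily hX hX (rfl : 2 + 2 * 4 = 2 + 2 * 4) Z y) :=
  isOfHodgeType_corrAction_of_type_self complexOrientationFamily exists_isReal_hodgeModel_holds hX hX rfl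
    (isOfHodgeType_of_mem_algebraicClasses_of_isSmoothProjective (hX.tensor_holds hX) 4 hZ) (by omega) (by omega) hy

/-- **The action `[Z]_*` of a rational class `Z` on `H²(X(ℂ); ℂ)` preserves rational classes** (complex
orientations). [cite: VoisinHodgeI2002, §11.1.2 Prop. 11.20] -/
theorem isRationalClass_corrAction_of_isRationalClass (hX : IsSmoothProjective 4 X) {Z : complexBetti (X ⊗ X) (2 * 4)}
    (hZrat : IsRationalClass Z) (y : complexBetti X 2) (hy : IsRationalClass y) :
    IsRationalClass (corrAction complexOrientationFamily hX hX (rfl : 2 + 2 * 4 = 2 + 2 * 4) Z y) :=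
  isRationalClass_corrAction_complexOrientationFamily hX hX rfl hZrat hy

/-! ### One rational algebraic class suffices -/

/-- **At `ρ(X) = 2`, ONE rational algebraic class `Z ∈ A⁴(X × X)` acting on the symplectic form by an irrational
number gives HC⁴(X)** (marked smooth projective `K3^{[2]}`-type `X`; modulo {Verbitsky–Guan, O'Grady,
`QInvAlgebraic`}): `hodgeConjectureFor_of_oneCycle_of_picard_two` with `t = [Z]_*`, rational and type-preserving by
the two lemmas above. [cite: Markman2024, §1.1 Thm. 1.1] [cite: Vangeemen2008, Lemma 3.2]
[cite: VoisinHodgeI2002, §11.1.2 Prop. 11.20] -/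
theorem hodgeConjectureFor_of_algebraicClass_of_picard_two
    (hV : VerbitskyGuan_cohomology_K3HilbertSquareType) (hO : OGrady2008_dualBBFClass_algebraic) (hQ : QInvAlgebraic)
    (hX : IsSmoothProjective 4 X) (hK : IsOfK3HilbertSquareType X) (hM : MarkedK3Sq[X, φ, P, z])
    (hρ2 : Module.finrank ℂ ↥(algebraicClasses X 1) = 2)
    {Z : complexBetti (X ⊗ X) (2 * 4)} (hZ : Z ∈ algebraicClasses (X ⊗ X) 4) (hZrat : IsRationalClass Z) {ev : ℂ}
    (hev_eq : corrAction complexOrientationFamily hX hX (rfl : 2 + 2 * 4 = 2 + 2 * 4) Z (φ.symm z) = ev • φ.symm z)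
    (hev : ∀ a : ℚ, (a : ℂ) ≠ ev) : HodgeConjectureFor 4 X :=
  hodgeConjectureFor_of_oneCycle_of_picard_two hV hO hQ hX hK hM hρ2
    (corrAction complexOrientationFamily hX hX (rfl : 2 + 2 * 4 = 2 + 2 * 4) Z)
    (isRationalClass_corrAction_of_isRationalClass hX hZrat)
    (typePreserving_corrAction_of_mem_algebraicClasses hX hZ) ⟨Z, hZ, fun _ => rfl⟩ hev_eq hev

/-- **At any Picard rank: ONE rational algebraic class acting on the symplectic form by an irrational number gives
HC⁴(X)**, given the arithmetic side condition (`d · m + ρ(X) = 23 ⇒ d` prime; automatic at `ρ(X) ∈ {1, 2}`),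
modulo the four facts {Verbitsky–Guan, O'Grady, Charles–Markman 2013, Markman 2024} (no CM clause).
[cite: CharlesMarkman2013, Thm. 1.1 (§1)] [cite: Markman2024, §1.1 Thm. 1.1] [cite: Vangeemen2008, Lemma 3.2] -/
theorem hodgeConjectureFor_of_algebraicClass_of_four_facts
    (hV : VerbitskyGuan_cohomology_K3HilbertSquareType) (hO : OGrady2008_dualBBFClass_algebraic)
    (hB : CharlesMarkman2013_lefschetzStandard_K3HilbertType) (hMk : Markman2024_rationalHodgeIsometry_algebraic_marked)
    (hX : IsSmoothProjective 4 X) (hK : IsOfK3HilbertSquareType X) (hM : MarkedK3Sq[X, φ, P, z])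
    (hρ : ∀ d m : ℕ, 2 ≤ d → 3 ≤ m → d * m + Module.finrank ℂ ↥(algebraicClasses X 1) = 23 → d.Prime)
    {Z : complexBetti (X ⊗ X) (2 * 4)} (hZ : Z ∈ algebraicClasses (X ⊗ X) 4) (hZrat : IsRationalClass Z) {ev : ℂ}
    (hev_eq : corrAction complexOrientationFamily hX hX (rfl : 2 + 2 * 4 = 2 + 2 * 4) Z (φ.symm z) = ev • φ.symm z)
    (hev : ∀ a : ℚ, (a : ℂ) ≠ ev) : HodgeConjectureFor 4 X :=
  hodgeConjectureFor_of_oneCycle_of_four_facts hV hO hB hMk hX hK hM hρ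
    (corrAction complexOrientationFamily hX hX (rfl : 2 + 2 * 4 = 2 + 2 * 4) Z)
    (isRationalClass_corrAction_of_isRationalClass hX hZrat)
    (typePreserving_corrAction_of_mem_algebraicClasses hX hZ) ⟨Z, hZ, fun _ => rfl⟩ hev_eq hev

/-- **Crux #5 BY NAME from one rational algebraic class per real-multiplication fourfold** (degree form): if every
marked smooth projective `K3^{[2]}`-type `X` with `ρ(X) ≤ 3` and genuine real multiplication carries a rational
algebraic `Z ∈ A⁴(X × X)` with `[Z]_* σ = ev · σ`, `deg minpoly_ℚ(ev) = k`, `k·j·m + ρ(X) ≠ 23` (`j ≥ 2`, `m ≥ 3`),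
then `LowPicardRealMultiplication` holds — modulo {Verbitsky–Guan, O'Grady, `QInvAlgebraic`}.
[cite: Markman2024, §1.1 Thm. 1.1] [cite: Vangeemen2008, Lemma 3.2] [cite: Zarhin1983HodgeGroupsK3, Thm. 1.5.1 and Thm. 1.6] -/
theorem lowPicardRealMultiplication_of_rationalAlgebraicClass
    (hV : VerbitskyGuan_cohomology_K3HilbertSquareType) (hO : OGrady2008_dualBBFClass_algebraic) (hQ : QInvAlgebraic)
    (hOne : ∀ (X : SchemeOver ℂ) (hX : IsSmoothProjective 4 X), IsOfK3HilbertSquareType X →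
      ∀ (φ : complexBetti X 2 ≃ₗ[ℂ] (K3HilbertIndex → ℂ)) (P : complexBetti X (2 * 4)) (z : K3HilbertIndex → ℂ),
      MarkedK3Sq[X, φ, P, z] → Module.finrank ℂ ↥(algebraicClasses X 1) ≤ 3 → RM[X, φ, z] →
      ∃ (k : ℕ) (Z : complexBetti (X ⊗ X) (2 * 4)), Z ∈ algebraicClasses (X ⊗ X) 4 ∧ IsRationalClass Z ∧
        (∀ j m : ℕ, 2 ≤ j → 3 ≤ m → k * j * m + Module.finrank ℂ ↥(algebraicClasses X 1) ≠ 23) ∧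
        ∃ ev : ℂ, corrAction complexOrientationFamily hX hX (rfl : 2 + 2 * 4 = 2 + 2 * 4) Z (φ.symm z) =
          ev • φ.symm z ∧ (minpoly ℚ ev).natDegree = k) :
    Summit.HodgeConjecture.HodgeConjecture.Theses.MarkmanPartnerTransport.LowPicardRealMultiplication := by
  refine lowPicardRealMultiplication_of_realMultiplicationCycle hV hO hQ fun X hX hK φ P z hM hρ hRM => ?_
  obtain ⟨k, Z, hZ, hZrat, hk, ev, hev_eq, hdeg⟩ := hOne X hX hK φ P z hM hρ hRM
  exact ⟨k, corrAction complexOrientationFamily hX hX (rfl : 2 + 2 * 4 = 2 + 2 * 4) Z, hk,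
    isRationalClass_corrAction_of_isRationalClass hX hZrat, typePreserving_corrAction_of_mem_algebraicClasses hX hZ,
    ⟨Z, hZ, fun _ => rfl⟩, ev, hev_eq, hdeg⟩

end Summit.HodgeConjecture.HodgeConjecture.Theorems.MarkmanPartnerTransport.PartnerLattice

end
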